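import Summits.RiemannHypothesis.RiemannHypothesis.Theorems.ThetaTier2RowSound
import HarnessLib

/-!
# THETA tier-2 kernel rows — twin primes `1301 ≤ q ≤ 1949` (module 3 of 13; cc-s2-1, WEIL typing lane; RH-FREE bookkeeping)

Data module of the tier-2 theta certificate (THETA-CERT-cc6 §E; HOME/cc-s2-1/gen22/TIER2-KERNEL-SPEC.md; soundness chain
`ThetaTier2Check … ThetaTier2RowSound`): the rows `(q, q⁺, m, δ·10¹², menu, k)` — `m = 5`, `δ = ⌊0.98·δ_q·10¹²⌋/10¹²` with
`δ_q = ½ log(q⁺/q)`, menu `0` = thin seed `(1/20, 19/20, 1)`, `η′ = 1/100` (menu `1` = `(1/4, 3/5, 1)`, `η′ = 1/20` for `q = 179, 191`),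
`t₀ = 2⁻¹⁵`; `K = 6`, `τ = 1/100`, `D = 3`, `W_l = 4`, `J = 64` — for the twin primes `1301 ≤ q ≤ 1949` in the range of the route item
`stmt-RiemannHypothesis-19172` (`WallsTenKTwin`, `route-RiemannHypothesis-WeilSemilocal`), checked in the kernel by `Row2.check`
(`decide +kernel`, ≈ 14 s per row), and the resulting REAL statements `T2Valid r.inp r.real ∧ r.RowFacts` (`Row2.check_sound`) that the
E-side assembly turns into `UC(q)`.  Nothing here bears on the truth of RH.
-/

set_option linter.dupNamespace false  -- the mandated namespace repeats `RiemannHypothesis`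

namespace Summit.RiemannHypothesis.RiemannHypothesis.Theorems.ThetaTier2

/-- Twin rows `1301 ≤ q ≤ 1619` (8 rows). [this cell, TIER2-KERNEL-SPEC §4] -/
def twinRows03_1 : List Row2 := [
  ⟨1301, 1303, 5, 752688320, 0, 15⟩, ⟨1319, 1321, 5, 742424384, 0, 15⟩, ⟨1427, 1429, 5, 686274621, 0, 15⟩, ⟨1451, 1453, 5, 674931236, 0, 15⟩,
  ⟨1481, 1483, 5, 661268656, 0, 15⟩, ⟨1487, 1489, 5, 658602249, 0, 15⟩, ⟨1607, 1609, 5, 609452814, 0, 15⟩, ⟨1619, 1621, 5, 604938348, 0, 15⟩ ]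

/-- The kernel verdict for `twinRows03_1`. [this cell, THETA-CERT-cc6 §E6] -/
theorem twinRows03_1_check : twinRows03_1.all Row2.check = true := by
  decide +kernel

/-- (K1)–(K7) and the row facts at every row of `twinRows03_1`. [this cell, THETA-CERT-cc6 §E6] -/
theorem twinRows03_1_valid : ∀ r ∈ twinRows03_1, T2Valid r.inp r.real ∧ r.RowFacts :=
  fun r hr => r.check_sound (List.all_eq_true.1 twinRows03_1_check r hr)

/-- Twin rows `1667 ≤ q ≤ 1949` (8 rows). [this cell, TIER2-KERNEL-SPEC §4] -/
def twinRows03_2 : List Row2 := [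
  ⟨1667, 1669, 5, 587530046, 0, 15⟩, ⟨1697, 1699, 5, 577149654, 0, 15⟩, ⟨1721, 1723, 5, 569105755, 0, 15⟩, ⟨1787, 1789, 5, 548098491, 0, 15⟩,
  ⟨1871, 1873, 5, 523504323, 0, 15⟩, ⟨1877, 1879, 5, 521831785, 0, 15⟩, ⟨1931, 1933, 5, 507246422, 0, 15⟩, ⟨1949, 1951, 5, 502564146, 0, 15⟩ ]

/-- The kernel verdict for `twinRows03_2`. [this cell, THETA-CERT-cc6 §E6] -/
theorem twinRows03_2_check : twinRows03_2.all Row2.check = true := by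
  decide +kernel

/-- (K1)–(K7) and the row facts at every row of `twinRows03_2`. [this cell, THETA-CERT-cc6 §E6] -/
theorem twinRows03_2_valid : ∀ r ∈ twinRows03_2, T2Valid r.inp r.real ∧ r.RowFacts :=
  fun r hr => r.check_sound (List.all_eq_true.1 twinRows03_2_check r hr)

end Summit.RiemannHypothesis.RiemannHypothesis.Theorems.ThetaTier2
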